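import Mathlib
import Summits.Ventures.PercRepro2.SwOutMixedArmsClosureCube

/-!
# The several-arms raw cube under the closure AL⁺, with pieces: vocabulary and moves (blind cell
PercRepro2, night-4 g21, 2026-08-27; proofs/NIGHT4-G21.md §5′, §6)

`ArmLowerPlus`: the closure of `MixedBaseR.mem_tgtU_of_lePlus` — between non-leaking points,
`s`, `a`, `e`, `f` may go down and `uP` may change arbitrarily, provided every u–p_r class that
turns blue does so with some u-arm red before and some u-arm blue after.  It contains `ArmLower`
and `RaiseUP`.  With pieces the leak calculus reads: at a point with a red u-arm an attached arm
has blue outside edges and red pieces; at a point with a blue u-arm a dropped arm has red outside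
edges and blue pieces.  The UNIFORM points `(s, C ∘ arm, C, C, f)` never leak; a point of `Q` with a
red u-arm reaches every uniform point below it with a blue u-arm (`mem_uniform_of_red`), and a
T-slab point reaches the uniform point of its attached set (`mem_uniform_top`).
-/

namespace Summit.Ventures.PercRepro2

namespace MixedArms

open scoped Classical

variable {ι ρ ν κ : Type*}

section Plus

variable (arm : ν → ρ) (Q : Set (PtR ι ρ ν κ))

/-- **The closure AL⁺**: `s`, `a`, `e`, `f` down, `uP` arbitrary, every u–p class that turns blue
doing so with some u-arm red at `p` and some u-arm blue at `q` (the closure of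
`MixedBaseR.mem_tgtU_of_lePlus`). -/
def ArmLowerPlus : Prop :=
  ∀ p q, ¬ Leak p arm → ¬ Leak q arm → q.1 ≤ p.1 → q.2.1 ≤ p.2.1 → q.2.2.2.1 ≤ p.2.2.2.1 →
    q.2.2.2.2 ≤ p.2.2.2.2 →
    (∀ r, p.2.2.1 r ≤ q.2.2.1 r ∨ ((∃ j, p.1 j = true) ∧ ∃ j, q.1 j = false)) → p ∈ Q → q ∈ Q

variable {arm Q}

/-- AL⁺ contains the raw-lower moves with the u–p condition. -/
lemma ArmLowerPlus.armLower (h : ArmLowerPlus arm Q) : ArmLower arm Q := by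
  intro p q hp hq hle huP hpQ
  obtain ⟨hs, ha, -, he, hf⟩ := hle
  refine h p q hp hq hs ha he hf (fun r => ?_) hpQ
  rcases huP r with h1 | h2
  · exact Or.inl (le_of_eq h1.symm)
  · exact Or.inr h2

/-- AL⁺ contains raising `uP`. -/
lemma ArmLowerPlus.raiseUP (h : ArmLowerPlus arm Q) : RaiseUP arm Q := by
  intro p q hp hq h1 h2 h3 h4 h5 hpQ
  exact h p q hp hq (le_of_eq h1) (le_of_eq h2) (le_of_eq h4) (le_of_eq h5)
    (fun r => Or.inl (h3 r)) hpQ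

end Plus

section LeakCalculus

variable {arm : ν → ρ}

/-- At a non-leaking point with a red u-arm, `uP ≤ e`. -/
lemma uP_le_e_of_red' {p : PtR ι ρ ν κ} (hp : ¬ Leak p arm) (hs : ∃ j, p.1 j = true) :
    p.2.2.1 ≤ p.2.2.2.1 := by
  intro r
  rw [Bool.le_iff_imp]
  intro hu
  by_contra he
  exact hp ⟨r, Or.inl ⟨hs, hu, Or.inl (by simpa using he)⟩⟩

/-- At a non-leaking point with a red u-arm, the pieces of an attached arm are red. -/
lemma piece_of_red' {p : PtR ι ρ ν κ} (hp : ¬ Leak p arm) (hs : ∃ j, p.1 j = true) (i : ν)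
    (hu : p.2.2.1 (arm i) = true) : p.2.1 i = true := by
  by_contra ha
  exact hp ⟨arm i, Or.inl ⟨hs, hu, Or.inr ⟨i, rfl, by simpa using ha⟩⟩⟩

/-- At a non-leaking point with a blue u-arm, `e ≤ uP`. -/
lemma e_le_uP_of_blue' {p : PtR ι ρ ν κ} (hp : ¬ Leak p arm) (hs : ∃ j, p.1 j = false) :
    p.2.2.2.1 ≤ p.2.2.1 := by
  intro r
  rw [Bool.le_iff_imp]
  intro he
  by_contra hu
  exact hp ⟨r, Or.inr ⟨hs, by simpa using hu, Or.inl he⟩⟩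

/-- At a non-leaking point with a blue u-arm, the pieces of a dropped arm are blue. -/
lemma piece_of_blue' {p : PtR ι ρ ν κ} (hp : ¬ Leak p arm) (hs : ∃ j, p.1 j = false) (i : ν)
    (hu : p.2.2.1 (arm i) = false) : p.2.1 i = false := by
  by_contra ha
  exact hp ⟨arm i, Or.inr ⟨hs, hu, Or.inr ⟨i, rfl, by simpa using ha⟩⟩⟩

/-- The uniform point `(s, C ∘ arm, C, C, f)`. -/
def uniformPt (arm : ν → ρ) (s : Config ι) (C : ρ → Bool) (f : Config κ) : PtR ι ρ ν κ :=
  (s, fun i => C (arm i), C, C, f)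

/-- A uniform point is a core point. -/
lemma core_uniformPt (s : Config ι) (C : ρ → Bool) (f : Config κ) :
    Core (uniformPt arm s C f) arm := ⟨fun _ => rfl, fun _ => rfl⟩

/-- A uniform point does not leak. -/
lemma not_leak_uniformPt (s : Config ι) (C : ρ → Bool) (f : Config κ) :
    ¬ Leak (uniformPt arm s C f) arm := not_leak_of_core arm (core_uniformPt s C f)

/-- A non-leaking point with a red u-arm lies above the uniform point of any `C ≤ uP` at any lower
`s` and `f`. -/
lemma uniformPt_le {p : PtR ι ρ ν κ} (hp : ¬ Leak p arm) (hs : ∃ j, p.1 j = true)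
    {s : Config ι} {C : ρ → Bool} {f : Config κ} (hs1 : s ≤ p.1) (hC : C ≤ p.2.2.1)
    (hf : f ≤ p.2.2.2.2) : uniformPt arm s C f ≤ p := by
  refine ⟨hs1, fun i => ?_, hC, le_trans hC (uP_le_e_of_red' hp hs), hf⟩
  rw [Bool.le_iff_imp]
  intro hCi
  exact piece_of_red' hp hs i (Bool.le_iff_imp.1 (hC (arm i)) hCi)

end LeakCalculus

section Moves

variable [Nonempty ι] {arm : ν → ρ} {Q : Set (PtR ι ρ ν κ)}

omit [Nonempty ι] in
/-- **Realising a uniform point with a blue u-arm**: a point of `Q` with a red u-arm reaches every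
uniform point below it (in `s`, `uP`, `f`) whose `s` has a blue u-arm. -/
lemma mem_uniform_of_red (hP : ArmLowerPlus arm Q) {p : PtR ι ρ ν κ} (hp : p ∈ Q)
    (hpL : ¬ Leak p arm) (hs : ∃ j, p.1 j = true) {s : Config ι} {C : ρ → Bool} {f : Config κ}
    (hs1 : s ≤ p.1) (hC : C ≤ p.2.2.1) (hf : f ≤ p.2.2.2.2) (hs' : ∃ j, s j = false) :
    uniformPt arm s C f ∈ Q := by
  obtain ⟨h1, h2, -, h4, h5⟩ := uniformPt_le hpL hs hs1 hC hf
  exact hP p _ hpL (not_leak_uniformPt s C f) h1 h2 h4 h5 (fun _ => Or.inr ⟨hs, hs'⟩) hp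

/-- **The uniform point of the attached set**: a T-slab point `(⊤, a, A, B, f)` of `Q` reaches
`(⊤, A ∘ arm, A, A, f)` (its pieces of dropped arms blue, its outside bits down to `A`). -/
lemma mem_uniform_top (hP : ArmLowerPlus arm Q) {p : PtR ι ρ ν κ} (hp : p ∈ Q)
    (hpL : ¬ Leak p arm) (hs : ∀ j, p.1 j = true) :
    uniformPt arm p.1 p.2.2.1 p.2.2.2.2 ∈ Q := by
  have hr : ∃ j, p.1 j = true := ⟨Classical.arbitrary ι, hs _⟩
  obtain ⟨-, h2, -, h4, -⟩ := uniformPt_le hpL hr le_rfl le_rfl le_rfl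
  exact hP p _ hpL (not_leak_uniformPt _ _ _) le_rfl h2 h4 le_rfl (fun _ => Or.inl le_rfl) hp

end Moves

end MixedArms

end Summit.Ventures.PercRepro2
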